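import Summits.AtomisticToContinuum.BoseEinsteinCondensation.Theses.BECInsertionCorrector
import Summits.AtomisticToContinuum.BoseEinsteinCondensation.Theses.BECSectorPoincareTwoScale
import Summits.AtomisticToContinuum.BoseEinsteinCondensation.Theorems.StaticResponseBound.Negative.Basic
import Summits.AtomisticToContinuum.BoseEinsteinCondensation.Theorems.StaticResponseBound.Negative.ModulationBootstrapEndgame
import Summits.AtomisticToContinuum.BoseEinsteinCondensation.Theorems.BECInsertionCorrectorStaticResponseBoundFreeSquare
import Summits.AtomisticToContinuum.BoseEinsteinCondensation.Theorems.BECInsertionCorrectorStaticResponseBoundTruncationCompactness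
import Summits.AtomisticToContinuum.BoseEinsteinCondensation.Theorems.BECInsertionCorrectorStaticResponseBoundModulationToolkit
import Summits.AtomisticToContinuum.BoseEinsteinCondensation.Theorems.BECInsertionCorrectorStaticResponseBoundKineticBranchOfUv
import Summits.AtomisticToContinuum.BoseEinsteinCondensation.Theorems.BECInsertionCorrectorStaticResponseBoundEcsfToTorusHyperuniformity
import Literature.MathematicalPhysics.QuantumManyBody.PeriodicFormDomain
import Literature.MathematicalPhysics.QuantumManyBody.WeightedCorrector
import Literature.MathematicalPhysics.QuantumManyBody.PeriodicBoseGasScatteringODE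
import Literature.MathematicalPhysics.QuantumManyBody.BoseGasStructureFactor

/-!
# Line `uv-thomson-force-wave` — skeleton v4 (seat c1) for the crux `BECInsertionCorrector.StaticResponseBound`
(crux item stmt-AtomisticToContinuum-12057; lead prover-line-stmt-AtomisticToContinuum-12057-c1-0, 2026-08-16)

Skeleton v3 (lead -0) reduced the crux to `InfraredHalf ∧ KineticBranch` and the kinetic (UV) branch to
`TruncationLimit(⟸ MaxFormBound) ∧ ModulationBootstrap(⟸ F1) ∧ ThomsonReduction ∧ UvForceWaveBound(S5) ∧ FreeSquare`,
with S4, S6 and the two bridges landed.  Seat c1 RESHAPES the UV input (v4):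

* **`stub_uvCurvatureBound` (NEW, crux-sized, replaces S5 + S3|F1 + S4 on the critical path).**  The content of S5 —
  N-uniform control of the static susceptibility of the WEAKLY MODULATED ground states on the UV window (drefute g2:
  S5 ⟺ pointwise-in-`s` curvature control; `…UvSusceptibilityEquiv.lean`) — stated DIRECTLY on the exact modulated
  ground-state energy `E_n(s) := inf {E_{v_n}(Ψ) + s⟨∑ⱼcos(p·xⱼ)⟩_Ψ : Ψ finite energy}` of the truncations
  `v_n = min(v,n)` as a LOCAL SYMMETRIC SECOND-DIFFERENCE bound `E_n(s+δ) + E_n(s−δ) − 2E_n(s) ≥ −2(KN/|p|² + ε)δ²`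
  at every weak coupling `s² ≤ |p|²E₀(v_n)/N`, uniformly in `n ≥ n₀`, `N ≥ 1` and `k` on `Λρa ≤ |p|²`.  No minimiser,
  no positivity, no `C¹` regularity of ground states is quantified: F1 (`stub_modulatedMinimiserExists`: Perron–Frobenius +
  regularity for the modulated problem, XL) LEAVES THE CONE.  The all-`t` passage is the landed maximum-principle lemma
  `UvThomsonG3.quadratic_lower_bound_of_second_differences` (p76457, sharp constant) applied to `E_n`, whose three
  hypotheses — continuity, `E_n(t) ≤ E_n(0)`, local second differences — are `stub_modInfBasic` (value at `0`, infimum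
  bounds, `N`-Lipschitz), `stub_modInfTranslate` (half-wavelength translate, `k ≠ 0`) and the curvature stub.
  The truncation is KEPT (bounded `v_n` ⇒ connected configuration space ⇒ simple ground state ⇒ `E_n` analytic, so a
  curvature statement is faithful; for `v` itself a caging hard set could produce a concave kink of `E` inside the
  window, which would falsify a pointwise curvature bound without touching the crux's secant form), hence
  `stub_maxFormBound` (classical, XL; ⟹ `TruncationLimit` by the landed `truncationLimit_of_maxFormBound`, p77117)
  remains the ONE classical debt of the UV half.
* **Kill-edge by name for S1.**  `stub_infraredHalf` (the IR half, crux-sized, = the sibling line's deliverable) implies the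
  sibling route's open crux `BECSectorPoincareTwoScale.TorusHyperuniformity` (stmt-9093) VERBATIM — for near-minimisers,
  non-vacuously — via `stub_nearMinCosSqMoment` (near-minimiser variation: crux body at `(N,L,k)` ⇒ second moment of the
  density wave of every `δ`-near-minimiser, fixed volume, M–L) and `stub_torusHyperuniformityPackaging` (quarter-wavelength
  translate for the `sin²` half, density window, Ruelle finiteness, 9093 bookkeeping; M).

Composition (sorry-free here, modulo the registered stubs):
`kineticBranch_of_curvature : TruncationLimit → ModInfBasic → ModInfTranslate → UvCurvatureBound → FreeSquare → KineticBranch`,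
`body_of_halves`, `StaticResponseBound_of : StaticResponseBound` (BY NAME), and
`torusHyperuniformity_of_infraredHalf : InfraredHalf → NearMinCosSqMoment → Packaging → TorusHyperuniformity`.
The ALTERNATIVE UV package of v3 (`MaxFormBound → F1 → S5 → KineticBranch`) stays available as the landed
`StableFractionSquareCompletion.kineticBranch_of_uvStubs` (p87668); nothing of v3 is invalidated.

Disproof.lean (gen 2, re-read 2026-08-16T10:35Z) honoured: §A (discriminant form) is exactly the hypothesis shape of
`stub_nearMinCosSqMoment`; §B `k ≠ 0` is used by `stub_modInfTranslate` (translate flips the sign) and the packaging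
(quarter-wavelength translate); §E the finite-energy guard: every infimum runs over `{Ψ // periodicEnergy _ Ψ ≠ ⊤}` and every
`toReal` is taken on finite energies; §C `C ≥ 1/2`: the composition outputs `C = max(K,1) + 1 ≥ 2`; §G `ineq_N_zero`
imported; §H no arbitrary charge functions anywhere.  `## Targets`: none registered.
-/

noncomputable section

namespace Summit.AtomisticToContinuum.BoseEinsteinCondensation.Cruxes.StaticResponseBound.UvThomsonForceWave

open MeasureTheory Filter UnitAddTorus
open scoped ENNReal NNReal BigOperators Topology InnerProductSpace
open Literature.MathematicalPhysics.QuantumManyBody.BoseGas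
open Summit.AtomisticToContinuum.BoseEinsteinCondensation.Theses
open Summit.AtomisticToContinuum.BoseEinsteinCondensation.Theses.BECInsertionCorrector
open Summit.AtomisticToContinuum.BoseEinsteinCondensation.Theorems.StaticResponseBound.Negative

-- The measure on `ℝ/ℤ` is the Haar PROBABILITY measure, as in `PeriodicFormDomain.lean` (text of `stub_maxFormBound`).
attribute [local instance] Literature.MathematicalPhysics.QuantumManyBody.BoseGas.formDomain_measureSpace
  Literature.MathematicalPhysics.QuantumManyBody.BoseGas.formDomain_isProbabilityMeasure
  Literature.MathematicalPhysics.QuantumManyBody.BoseGas.formDomain_isProbabilityMeasure_pi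

/-! ## Vocabulary (abbreviations over existing declarations; the registered texts inline them) -/

/-- The **modulated ground-state energy** `E_w(s) = inf {E_w(Ψ) + s⟨∑ⱼcos(p·xⱼ)⟩_Ψ : Ψ periodic, finite energy}`
of `H_w + s V_p` at fixed `(N, L)`, `p = 2πk/L` (a real infimum over the finite-energy periodic `C¹` core; junk `0`
if the core has no finite-energy state, i.e. `E₀ = ⊤`). -/
def modInf (w : ℝ → ℝ≥0∞) (N : ℕ) (L : ℝ) (k : Fin 3 → ℤ) (s : ℝ) : ℝ :=
  ⨅ Ψ : {Ψ : PeriodicTrialState N L // periodicEnergy w Ψ ≠ ⊤},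
    ((periodicEnergy w Ψ.1).toReal + s * cosMean L k Ψ.1)

/-- **S1 `InfraredHalf`** (v3 verbatim): the IR half of the crux for every window `M₀`. -/
def InfraredHalf : Prop :=
  ∀ v : ℝ → ℝ≥0∞, IsRepulsiveFiniteRange v → ∀ M₀ : ℝ, 0 < M₀ →
    ∃ ρ₀ : ℝ, 0 < ρ₀ ∧ ∃ C : ℝ, 0 < C ∧
      ∀ ρ : ℝ, 0 < ρ → ρ < ρ₀ → ∀ N : ℕ, 0 < N → ∀ k : Fin 3 → ℤ, k ≠ 0 →
        psq (sideLength ρ N) k ≤ M₀ ^ 2 * (ρ * (scatteringLength v).toReal) →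
        ∀ t : ℝ, ∀ Ψ : PeriodicTrialState N (sideLength ρ N), periodicEnergy v Ψ ≠ ⊤ →
          Ineq v C ρ N k t Ψ

/-- **S2 `TruncationLimit`** (v3 verbatim; a theorem modulo `stub_maxFormBound`). -/
def TruncationLimit : Prop :=
  ∀ v : ℝ → ℝ≥0∞, IsRepulsiveFiniteRange v → ∀ (N : ℕ) (L : ℝ), 0 < L →
    periodicGroundStateEnergy v N L ≠ ⊤ →
    ∀ ε : ℝ, 0 < ε → ∃ n₁ : ℕ, ∀ n : ℕ, n₁ ≤ n →
      (periodicGroundStateEnergy v N L).toReal ≤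
        (periodicGroundStateEnergy (truncPotential v n) N L).toReal + ε

/-- **`ModInfBasic`** (NEW, provable, S–M): the three order-theoretic facts about `modInf` the glue needs — it is below
every member of the family, equals `E₀.toReal` at `s = 0` when `E₀ ≠ ⊤`, and is `N`-Lipschitz in `s` when `E₀ ≠ ⊤`. -/
def ModInfBasic : Prop :=
  ∀ (w : ℝ → ℝ≥0∞) (N : ℕ) (L : ℝ), 0 < L → ∀ k : Fin 3 → ℤ,
    (∀ (s : ℝ) (Ψ : PeriodicTrialState N L), periodicEnergy w Ψ ≠ ⊤ →
      modInf w N L k s ≤ (periodicEnergy w Ψ).toReal + s * cosMean L k Ψ) ∧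
    (periodicGroundStateEnergy w N L ≠ ⊤ → modInf w N L k 0 = (periodicGroundStateEnergy w N L).toReal) ∧
    (periodicGroundStateEnergy w N L ≠ ⊤ → ∀ s s' : ℝ, |modInf w N L k s - modInf w N L k s'| ≤ N * |s - s'|)

/-- **`ModInfTranslate`** (NEW, provable, S): `E_w(t) ≤ E_w(0)` for `k ≠ 0` (half-wavelength translate). -/
def ModInfTranslate : Prop :=
  ∀ (w : ℝ → ℝ≥0∞) (N : ℕ) (L : ℝ), 0 < L → ∀ k : Fin 3 → ℤ, k ≠ 0 →
    ∀ t : ℝ, modInf w N L k t ≤ modInf w N L k 0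

/-- **`UvCurvatureBound`** (NEW, crux-sized; replaces S5 ∧ S3|F1 ∧ S4): local symmetric second differences of the
modulated ground-state energy of the truncations `v_n`, `n ≥ n₀`, are `≥ −2(KN/|p|² + ε)δ²` at every weak coupling
`s² ≤ |p|² E₀(v_n)/N` on the UV window `Λρa ≤ |p|²`, uniformly in `n, N, k`. -/
def UvCurvatureBound : Prop :=
  ∀ v : ℝ → ℝ≥0∞, IsRepulsiveFiniteRange v →
    ∃ Λ : ℝ, 1 ≤ Λ ∧ ∃ ρ₁ : ℝ, 0 < ρ₁ ∧ ∃ K : ℝ, 0 ≤ K ∧ ∃ n₀ : ℕ, ∀ n : ℕ, n₀ ≤ n →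
      ∀ ρ : ℝ, 0 < ρ → ρ < ρ₁ → ∀ N : ℕ, 1 ≤ N → ∀ k : Fin 3 → ℤ, k ≠ 0 →
        Λ * (ρ * (scatteringLength v).toReal) ≤ psq (sideLength ρ N) k →
        ∀ s : ℝ, s ^ 2 ≤ psq (sideLength ρ N) k *
            (periodicGroundStateEnergy (truncPotential v n) N (sideLength ρ N)).toReal / N →
        ∀ ε : ℝ, 0 < ε → ∃ δ₀ : ℝ, 0 < δ₀ ∧ ∀ δ : ℝ, 0 < δ → δ < δ₀ →
          -(2 * (K * N / psq (sideLength ρ N) k + ε) * δ ^ 2) ≤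
            modInf (truncPotential v n) N (sideLength ρ N) k (s + δ) +
              modInf (truncPotential v n) N (sideLength ρ N) k (s - δ) -
              2 * modInf (truncPotential v n) N (sideLength ρ N) k s

/-- **S6 `FreeSquare`** (v3 verbatim; LANDED p73757). -/
def FreeSquare : Prop :=
  ∀ (v : ℝ → ℝ≥0∞) (N : ℕ) (L : ℝ), 0 < L → ∀ (k : Fin 3 → ℤ), k ≠ 0 →
    ∀ (t : ℝ) (Ψ : PeriodicTrialState N L), periodicEnergy v Ψ ≠ ⊤ →
      -((N : ℝ) * t ^ 2 / psq L k) ≤ (periodicEnergy v Ψ).toReal + t * cosMean L k Ψ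

/-- **`KineticBranch`** (v3 verbatim): the UV half for SOME window parameter `M₀`. -/
def KineticBranch : Prop :=
  ∀ v : ℝ → ℝ≥0∞, IsRepulsiveFiniteRange v →
    ∃ M₀ : ℝ, 0 < M₀ ∧ ∃ ρ₀ : ℝ, 0 < ρ₀ ∧ ∃ C : ℝ, 0 < C ∧
      ∀ ρ : ℝ, 0 < ρ → ρ < ρ₀ → ∀ N : ℕ, 0 < N → ∀ k : Fin 3 → ℤ, k ≠ 0 →
        M₀ ^ 2 * (ρ * (scatteringLength v).toReal) < psq (sideLength ρ N) k →
        ∀ t : ℝ, ∀ Ψ : PeriodicTrialState N (sideLength ρ N), periodicEnergy v Ψ ≠ ⊤ →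
          Ineq v C ρ N k t Ψ

/-- **`NearMinCosSqMoment`** (NEW, provable, M–L; the lead's stub): at fixed `(N, L)` with `E₀ ≠ ⊤`, the crux's
discriminant family `E₀ − Bt² ≤ E_Ψ + t⟨∑cos⟩_Ψ` (all `t`, all finite-energy `Ψ`) at a mode `k ≠ 0` with `|p|² ≤ P` forces,
for every `ε > 0` and `δ = δ(ε, N, L, B, P) > 0` small, the second moment `∫(∑ⱼcos(p·xⱼ))²|Φ|² ≤ 2√(B·N|p|²) + ε` for every
`δ`-near-minimiser `Φ` (test states `(1+ηV_p)Φ/‖·‖`, `(1+σV_p²)Φ/‖·‖`; first variations are `O(√δ)` by the variational principle). -/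
def NearMinCosSqMoment : Prop :=
  ∀ (v : ℝ → ℝ≥0∞) (N : ℕ) (L : ℝ), 0 < L → ∀ (B P : ℝ), 0 ≤ B → 0 ≤ P →
    periodicGroundStateEnergy v N L ≠ ⊤ →
    ∀ ε : ℝ, 0 < ε → ∃ δ : ℝ, 0 < δ ∧ ∀ k : Fin 3 → ℤ, k ≠ 0 → psq L k ≤ P →
      (∀ (t : ℝ) (Ψ : PeriodicTrialState N L), periodicEnergy v Ψ ≠ ⊤ →
        (periodicGroundStateEnergy v N L).toReal - B * t ^ 2 ≤
          (periodicEnergy v Ψ).toReal + t * cosMean L k Ψ) →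
      ∀ Φ : PeriodicTrialState N L,
        periodicEnergy v Φ ≤ periodicGroundStateEnergy v N L + ENNReal.ofReal δ →
        ∫ X in cellN N L, (∑ j, Real.cos (2 * Real.pi / L * ∑ i, (k i : ℝ) * X j i)) ^ 2 * ‖Φ.ψ X‖ ^ 2 ≤
          2 * Real.sqrt (B * (N * psq L k)) + ε

/-- **`TorusHyperuniformityPackaging`** (NEW, provable, M): the IR half and the near-minimiser moment bound give the sibling
route's crux `TorusHyperuniformity` (stmt-9093) BY NAME (quarter-wavelength translate for the `sin²` half of `|ρ̂_p|²`,
density window `ρ/2 ≤ N/L³ ≤ 2ρ` via `ρ' = N/L³`, Ruelle finiteness `ecsf9093_periodicGroundStateEnergy_ne_top`, the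
bookkeeping lemmas `ecsf9093_*` of `…EcsfToTorusHyperuniformity.lean`). -/
def TorusHyperuniformityPackaging : Prop :=
  InfraredHalf → NearMinCosSqMoment → BECSectorPoincareTwoScale.TorusHyperuniformity

/-! ## The REGISTERED stubs (texts written out in tree vocabulary: `modInf` inlined) -/

/-- S1 (crux-sized, = sibling line's `StaticResponseBoundPhonon`): the infrared half — verbatim `InfraredHalf`. -/
theorem stub_infraredHalf :
    ∀ v : ℝ → ℝ≥0∞, IsRepulsiveFiniteRange v → ∀ M₀ : ℝ, 0 < M₀ →
      ∃ ρ₀ : ℝ, 0 < ρ₀ ∧ ∃ C : ℝ, 0 < C ∧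
        ∀ ρ : ℝ, 0 < ρ → ρ < ρ₀ → ∀ N : ℕ, 0 < N → ∀ k : Fin 3 → ℤ, k ≠ 0 →
          psq (sideLength ρ N) k ≤ M₀ ^ 2 * (ρ * (scatteringLength v).toReal) →
          ∀ t : ℝ, ∀ Ψ : PeriodicTrialState N (sideLength ρ N), periodicEnergy v Ψ ≠ ⊤ →
            Ineq v C ρ N k t Ψ := by
  sorry

/-- (MaxFormBound) classical XL debt, v3 verbatim: the Bose-symmetric periodic `C¹` core realises the infimum of the maximal
hard-core form — hypothesis `hcore` of the landed `truncationLimit_of_maxFormBound`.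
[cite: B. Simon, J. Operator Theory 1 (1979) 37; Adams–Hedberg Thm 9.1.3] -/
theorem stub_maxFormBound :
    ∀ v : ℝ → ℝ≥0∞, IsRepulsiveFiniteRange v → ∀ (N : ℕ) (L : ℝ), 0 < L →
      ∀ η : Lp ℂ 2 (volume : Measure (UnitAddTorus (Fin N × Fin 3))), ‖η‖ = 1 →
        (∀ (σ : Equiv.Perm (Fin N)) (n : Fin N × Fin 3 → ℤ),
          ⟪(mFourierLp 2 (fun p : Fin N × Fin 3 => n (σ p.1, p.2)) :
              Lp ℂ 2 (volume : Measure (UnitAddTorus (Fin N × Fin 3)))), η⟫_ℂ =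
            ⟪(mFourierLp 2 n : Lp ℂ 2 (volume : Measure (UnitAddTorus (Fin N × Fin 3)))), η⟫_ℂ) →
        periodicGroundStateEnergy v N L ≤
          ∑' n : Fin N × Fin 3 → ℤ, ENNReal.ofReal (∑ p, (2 * Real.pi * (n p : ℝ) / L) ^ 2) *
              (‖⟪(mFourierLp 2 n : Lp ℂ 2 (volume : Measure (UnitAddTorus (Fin N × Fin 3)))), η⟫_ℂ‖₊ :
                ℝ≥0∞) ^ 2 +
            ∫⁻ t, periodicInteraction v L (fromUnitTorusN L t) *
              (‖(η : UnitAddTorus (Fin N × Fin 3) → ℂ) t‖₊ : ℝ≥0∞) ^ 2 := by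
  sorry

/-- `ModInfBasic` registered (text with `modInf` inlined). -/
theorem stub_modInfBasic :
    ∀ (w : ℝ → ℝ≥0∞) (N : ℕ) (L : ℝ), 0 < L → ∀ k : Fin 3 → ℤ,
      (∀ (s : ℝ) (Ψ : PeriodicTrialState N L), periodicEnergy w Ψ ≠ ⊤ →
        (⨅ Φ : {Φ : PeriodicTrialState N L // periodicEnergy w Φ ≠ ⊤},
            ((periodicEnergy w Φ.1).toReal + s * cosMean L k Φ.1)) ≤
          (periodicEnergy w Ψ).toReal + s * cosMean L k Ψ) ∧
      (periodicGroundStateEnergy w N L ≠ ⊤ →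
        (⨅ Φ : {Φ : PeriodicTrialState N L // periodicEnergy w Φ ≠ ⊤},
            ((periodicEnergy w Φ.1).toReal + 0 * cosMean L k Φ.1)) =
          (periodicGroundStateEnergy w N L).toReal) ∧
      (periodicGroundStateEnergy w N L ≠ ⊤ → ∀ s s' : ℝ,
        |(⨅ Φ : {Φ : PeriodicTrialState N L // periodicEnergy w Φ ≠ ⊤},
              ((periodicEnergy w Φ.1).toReal + s * cosMean L k Φ.1)) -
            (⨅ Φ : {Φ : PeriodicTrialState N L // periodicEnergy w Φ ≠ ⊤},
              ((periodicEnergy w Φ.1).toReal + s' * cosMean L k Φ.1))| ≤ N * |s - s'|) := by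
  sorry

/-- `ModInfTranslate` registered (text with `modInf` inlined). -/
theorem stub_modInfTranslate :
    ∀ (w : ℝ → ℝ≥0∞) (N : ℕ) (L : ℝ), 0 < L → ∀ k : Fin 3 → ℤ, k ≠ 0 → ∀ t : ℝ,
      (⨅ Φ : {Φ : PeriodicTrialState N L // periodicEnergy w Φ ≠ ⊤},
          ((periodicEnergy w Φ.1).toReal + t * cosMean L k Φ.1)) ≤
        (⨅ Φ : {Φ : PeriodicTrialState N L // periodicEnergy w Φ ≠ ⊤},
          ((periodicEnergy w Φ.1).toReal + 0 * cosMean L k Φ.1)) := by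
  sorry

/-- `UvCurvatureBound` registered (crux-sized; text with `modInf` inlined). -/
theorem stub_uvCurvatureBound :
    ∀ v : ℝ → ℝ≥0∞, IsRepulsiveFiniteRange v →
      ∃ Λ : ℝ, 1 ≤ Λ ∧ ∃ ρ₁ : ℝ, 0 < ρ₁ ∧ ∃ K : ℝ, 0 ≤ K ∧ ∃ n₀ : ℕ, ∀ n : ℕ, n₀ ≤ n →
        ∀ ρ : ℝ, 0 < ρ → ρ < ρ₁ → ∀ N : ℕ, 1 ≤ N → ∀ k : Fin 3 → ℤ, k ≠ 0 →
          Λ * (ρ * (scatteringLength v).toReal) ≤ psq (sideLength ρ N) k →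
          ∀ s : ℝ, s ^ 2 ≤ psq (sideLength ρ N) k *
              (periodicGroundStateEnergy (truncPotential v n) N (sideLength ρ N)).toReal / N →
          ∀ ε : ℝ, 0 < ε → ∃ δ₀ : ℝ, 0 < δ₀ ∧ ∀ δ : ℝ, 0 < δ → δ < δ₀ →
            -(2 * (K * N / psq (sideLength ρ N) k + ε) * δ ^ 2) ≤
              (⨅ Ψ : {Ψ : PeriodicTrialState N (sideLength ρ N) // periodicEnergy (truncPotential v n) Ψ ≠ ⊤},
                  ((periodicEnergy (truncPotential v n) Ψ.1).toReal +
                    (s + δ) * cosMean (sideLength ρ N) k Ψ.1)) +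
              (⨅ Ψ : {Ψ : PeriodicTrialState N (sideLength ρ N) // periodicEnergy (truncPotential v n) Ψ ≠ ⊤},
                  ((periodicEnergy (truncPotential v n) Ψ.1).toReal +
                    (s - δ) * cosMean (sideLength ρ N) k Ψ.1)) -
              2 * (⨅ Ψ : {Ψ : PeriodicTrialState N (sideLength ρ N) // periodicEnergy (truncPotential v n) Ψ ≠ ⊤},
                  ((periodicEnergy (truncPotential v n) Ψ.1).toReal +
                    s * cosMean (sideLength ρ N) k Ψ.1)) := by
  sorry

/-- `NearMinCosSqMoment` registered (verbatim). -/
theorem stub_nearMinCosSqMoment :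
    ∀ (v : ℝ → ℝ≥0∞) (N : ℕ) (L : ℝ), 0 < L → ∀ (B P : ℝ), 0 ≤ B → 0 ≤ P →
      periodicGroundStateEnergy v N L ≠ ⊤ →
      ∀ ε : ℝ, 0 < ε → ∃ δ : ℝ, 0 < δ ∧ ∀ k : Fin 3 → ℤ, k ≠ 0 → psq L k ≤ P →
        (∀ (t : ℝ) (Ψ : PeriodicTrialState N L), periodicEnergy v Ψ ≠ ⊤ →
          (periodicGroundStateEnergy v N L).toReal - B * t ^ 2 ≤
            (periodicEnergy v Ψ).toReal + t * cosMean L k Ψ) →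
        ∀ Φ : PeriodicTrialState N L,
          periodicEnergy v Φ ≤ periodicGroundStateEnergy v N L + ENNReal.ofReal δ →
          ∫ X in cellN N L, (∑ j, Real.cos (2 * Real.pi / L * ∑ i, (k i : ℝ) * X j i)) ^ 2 * ‖Φ.ψ X‖ ^ 2 ≤
            2 * Real.sqrt (B * (N * psq L k)) + ε := by
  sorry

/-- `TorusHyperuniformityPackaging` registered (text with `InfraredHalf`, `NearMinCosSqMoment` inlined). -/
theorem stub_torusHyperuniformityPackaging :
    (∀ v : ℝ → ℝ≥0∞, IsRepulsiveFiniteRange v → ∀ M₀ : ℝ, 0 < M₀ →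
      ∃ ρ₀ : ℝ, 0 < ρ₀ ∧ ∃ C : ℝ, 0 < C ∧
        ∀ ρ : ℝ, 0 < ρ → ρ < ρ₀ → ∀ N : ℕ, 0 < N → ∀ k : Fin 3 → ℤ, k ≠ 0 →
          psq (sideLength ρ N) k ≤ M₀ ^ 2 * (ρ * (scatteringLength v).toReal) →
          ∀ t : ℝ, ∀ Ψ : PeriodicTrialState N (sideLength ρ N), periodicEnergy v Ψ ≠ ⊤ →
            Ineq v C ρ N k t Ψ) →
    (∀ (v : ℝ → ℝ≥0∞) (N : ℕ) (L : ℝ), 0 < L → ∀ (B P : ℝ), 0 ≤ B → 0 ≤ P →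
      periodicGroundStateEnergy v N L ≠ ⊤ →
      ∀ ε : ℝ, 0 < ε → ∃ δ : ℝ, 0 < δ ∧ ∀ k : Fin 3 → ℤ, k ≠ 0 → psq L k ≤ P →
        (∀ (t : ℝ) (Ψ : PeriodicTrialState N L), periodicEnergy v Ψ ≠ ⊤ →
          (periodicGroundStateEnergy v N L).toReal - B * t ^ 2 ≤
            (periodicEnergy v Ψ).toReal + t * cosMean L k Ψ) →
        ∀ Φ : PeriodicTrialState N L,
          periodicEnergy v Φ ≤ periodicGroundStateEnergy v N L + ENNReal.ofReal δ →
          ∫ X in cellN N L, (∑ j, Real.cos (2 * Real.pi / L * ∑ i, (k i : ℝ) * X j i)) ^ 2 * ‖Φ.ψ X‖ ^ 2 ≤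
            2 * Real.sqrt (B * (N * psq L k)) + ε) →
    BECSectorPoincareTwoScale.TorusHyperuniformity := by
  sorry

/-! ## The stub statements by name (definitional unfolding) -/

theorem infraredHalf_holds : InfraredHalf := stub_infraredHalf
theorem modInfBasic_holds : ModInfBasic := stub_modInfBasic
theorem modInfTranslate_holds : ModInfTranslate := stub_modInfTranslate
theorem uvCurvatureBound_holds : UvCurvatureBound := stub_uvCurvatureBound
theorem nearMinCosSqMoment_holds : NearMinCosSqMoment := stub_nearMinCosSqMoment
theorem torusHyperuniformityPackaging_holds : TorusHyperuniformityPackaging := stub_torusHyperuniformityPackaging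
/-- S2 is a theorem modulo MaxFormBound (landed reduction p77117). -/
theorem truncationLimit_holds : TruncationLimit := truncationLimit_of_maxFormBound stub_maxFormBound
/-- S6 is LANDED (p73757). -/
theorem freeSquare_holds : FreeSquare := stub_freeSquare


/-! ## Small proved helpers for the composition (as in v3) -/

/-- `|p|² > 0` for `k ≠ 0`, `L ≠ 0`. [folklore] -/
theorem psq_pos' {L : ℝ} (hL : L ≠ 0) {k : Fin 3 → ℤ} (hk : k ≠ 0) : 0 < psq L k := by
  unfold psq
  have h1 : 0 < (2 * Real.pi / L) ^ 2 := by
    have : 2 * Real.pi / L ≠ 0 := div_ne_zero (by positivity) hL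
    positivity
  have h2 : 0 < ∑ i, (k i : ℝ) ^ 2 := by
    obtain ⟨i, hi⟩ : ∃ i, k i ≠ 0 := by
      by_contra h
      push Not at h
      exact hk (funext h)
    have hi' : (0 : ℝ) < (k i : ℝ) ^ 2 := by
      have : (k i : ℝ) ≠ 0 := by exact_mod_cast hi
      positivity
    exact lt_of_lt_of_le hi'
      (Finset.single_le_sum (f := fun l => (k l : ℝ) ^ 2) (fun l _ => sq_nonneg _) (Finset.mem_univ i))
  exact mul_pos h1 h2

/-- Monotonicity of the periodic energy under truncation of the potential. [folklore] -/
theorem periodicEnergy_truncPotential_le'' (v : ℝ → ℝ≥0∞) (n : ℕ) {N : ℕ} {L : ℝ}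
    (Ψ : PeriodicTrialState N L) : periodicEnergy (truncPotential v n) Ψ ≤ periodicEnergy v Ψ := by
  unfold periodicEnergy
  refine lintegral_mono fun X => ?_
  refine add_le_add le_rfl (mul_le_mul_left ?_ _)
  unfold periodicInteraction
  refine Finset.sum_le_sum fun i _ => Finset.sum_le_sum fun j _ => ?_
  unfold periodizedPotential
  exact ENNReal.tsum_le_tsum fun m => truncPotential_le v n _

/-- Monotonicity of the crux's inner inequality in the constant. [folklore] -/
theorem ineq_mono_C' {v : ℝ → ℝ≥0∞} {C C' ρ : ℝ} {N : ℕ} {k : Fin 3 → ℤ} {t : ℝ}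
    {Ψ : PeriodicTrialState N (sideLength ρ N)} (h : Ineq v C ρ N k t Ψ) (hCC' : C ≤ C') :
    Ineq v C' ρ N k t Ψ := by
  unfold Ineq at h ⊢
  have hmax : 0 ≤ max (ρ * (scatteringLength v).toReal) (psq (sideLength ρ N) k) :=
    le_max_of_le_right (psq_nonneg _ _)
  have hle : C * t ^ 2 * N / max (ρ * (scatteringLength v).toReal) (psq (sideLength ρ N) k) ≤
      C' * t ^ 2 * N / max (ρ * (scatteringLength v).toReal) (psq (sideLength ρ N) k) := by
    apply div_le_div_of_nonneg_right _ hmax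
    have : (0 : ℝ) ≤ t ^ 2 * N := by positivity
    nlinarith
  linarith

/-! ## The compositions (kernel-checked, no `sorry` of their own) -/

/-- **Fixed-volume modulation bound from local curvature** (replaces S3|F1 of v3): at fixed `(N, L, k)` with
`E₀(w) ≠ ⊤`, the order facts `ModInfBasic`, the translate `ModInfTranslate` and a local symmetric second-difference
bound `≥ −2(K′+ε)δ²` for the modulated ground-state energy at every `s² ≤ T` give
`E₀(w) − K′t² ≤ E_w(Ψ) + t⟨∑cos⟩_Ψ` for all `t² ≤ T` and all finite-energy `Ψ` — by the landed Schwarz maximum-principle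
lemma `UvThomsonG3.quadratic_lower_bound_of_second_differences` (p76457) applied to `s ↦ modInf w N L k s`. [folklore] -/
theorem modulationBound_of_curvature (hB : ModInfBasic) (hT : ModInfTranslate)
    {w : ℝ → ℝ≥0∞} {N : ℕ} {L : ℝ} (hL : 0 < L) {k : Fin 3 → ℤ} (hk : k ≠ 0)
    (hfin : periodicGroundStateEnergy w N L ≠ ⊤) {K' T : ℝ} (hK' : 0 ≤ K')
    (hcurv : ∀ s : ℝ, s ^ 2 ≤ T → ∀ ε : ℝ, 0 < ε → ∃ δ₀ : ℝ, 0 < δ₀ ∧ ∀ δ : ℝ, 0 < δ → δ < δ₀ →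
      -(2 * (K' + ε) * δ ^ 2) ≤
        modInf w N L k (s + δ) + modInf w N L k (s - δ) - 2 * modInf w N L k s)
    (t : ℝ) (ht : t ^ 2 ≤ T) (Ψ : PeriodicTrialState N L) (hΨ : periodicEnergy w Ψ ≠ ⊤) :
    (periodicGroundStateEnergy w N L).toReal - K' * t ^ 2 ≤
      (periodicEnergy w Ψ).toReal + t * cosMean L k Ψ := by
  obtain ⟨hle, h0, hlip⟩ := hB w N L hL k
  set E : ℝ → ℝ := fun s => modInf w N L k s with hE
  have hcont : Continuous E := by
    have hLip : LipschitzWith (N : ℝ≥0) E := by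
      refine LipschitzWith.of_dist_le_mul fun s s' => ?_
      rw [Real.dist_eq, Real.dist_eq]
      simpa using hlip hfin s s'
    exact hLip.continuous
  have hmax : ∀ t, E t ≤ E 0 := fun t => hT w N L hL k hk t
  have key := UvThomsonG3.quadratic_lower_bound_of_second_differences (E := E) (K := K') (T := T) hK' hcont hmax
    hcurv t ht
  have hE0 : E 0 = (periodicGroundStateEnergy w N L).toReal := h0 hfin
  have hEt : E t ≤ (periodicEnergy w Ψ).toReal + t * cosMean L k Ψ := hle t Ψ hΨ
  rw [hE0] at key
  exact key.trans hEt

/-- **The UV half from the reshaped stubs** (v4): `TruncationLimit → ModInfBasic → ModInfTranslate → UvCurvatureBound →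
FreeSquare → KineticBranch`, with `M₀ = √Λ`, `ρ₀ = ρ₁`, `C = C₁ + 1`, `C₁ = max(K, 1)`.
For `N ≥ 1`, `k ≠ 0` in the window `Λρa ≤ |p|²` (`max(ρa,|p|²) = |p|²`): if `|p|²·E₀(v) ≤ C₁N t²` the free square gives it;
otherwise `N t² < |p|²·E₀(v)` with room `δ`, so by S2 `t² ≤ |p|²·E₀(v_n)/N` for `n` large, and the curvature stub for
`v_n` (constant `KN/|p|²`) with `modulationBound_of_curvature` gives `E₀(v_n) − (KN/|p|²)t² ≤ E_{v_n}(Ψ) + t⟨∑cos⟩ ≤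
E_v(Ψ) + t⟨∑cos⟩`, and `E₀(v_n) → E₀(v)` (S2). [folklore] -/
theorem kineticBranch_of_curvature (h₂ : TruncationLimit) (hB : ModInfBasic) (hT : ModInfTranslate)
    (h₅ : UvCurvatureBound) (h₆ : FreeSquare) : KineticBranch := by
  intro v hv
  obtain ⟨Λ, hΛ, ρ₁, hρ₁, K, hK, n₀, hUV⟩ := h₅ v hv
  have hΛpos : 0 < Λ := lt_of_lt_of_le one_pos hΛ
  set C₁ : ℝ := max K 1 with hC₁def
  have hC₁ : 1 ≤ C₁ := le_max_right _ _
  have hKC₁ : K ≤ C₁ := le_max_left _ _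
  refine ⟨Real.sqrt Λ, Real.sqrt_pos.mpr hΛpos, ρ₁, hρ₁, C₁ + 1, by linarith, ?_⟩
  intro ρ hρ hρ1 N hNpos k hk hwin t Ψ hΨ
  rw [Real.sq_sqrt hΛpos.le] at hwin
  have hUVcase : Λ * (ρ * (scatteringLength v).toReal) ≤ psq (sideLength ρ N) k := hwin.le
  have hN1 : 1 ≤ N := hNpos
  have hNR : (0 : ℝ) < N := by exact_mod_cast hNpos
  have hL : 0 < sideLength ρ N := sideLength_pos hρ hNpos
  have hP : 0 < psq (sideLength ρ N) k := psq_pos' hL.ne' hk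
  have ha : 0 ≤ ρ * (scatteringLength v).toReal := mul_nonneg hρ.le ENNReal.toReal_nonneg
  have hΛρa : ρ * (scatteringLength v).toReal ≤ Λ * (ρ * (scatteringLength v).toReal) :=
    le_mul_of_one_le_left ha hΛ
  unfold Ineq
  have hmax : max (ρ * (scatteringLength v).toReal) (psq (sideLength ρ N) k) = psq (sideLength ρ N) k :=
    max_eq_right (hΛρa.trans hUVcase)
  rw [hmax]
  have hfree := h₆ v N (sideLength ρ N) hL k hk t Ψ hΨ
  have hE0nn : 0 ≤ (periodicGroundStateEnergy v N (sideLength ρ N)).toReal := ENNReal.toReal_nonneg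
  have hsplit : (C₁ + 1) * t ^ 2 * N / psq (sideLength ρ N) k =
      C₁ * t ^ 2 * N / psq (sideLength ρ N) k + (N : ℝ) * t ^ 2 / psq (sideLength ρ N) k := by
    ring
  rcases le_or_gt (psq (sideLength ρ N) k * (periodicGroundStateEnergy v N (sideLength ρ N)).toReal)
      (C₁ * N * t ^ 2) with hA | hBcase
  · -- large coupling: the free square
    have hE0le : (periodicGroundStateEnergy v N (sideLength ρ N)).toReal ≤
        C₁ * t ^ 2 * N / psq (sideLength ρ N) k := by
      rw [le_div_iff₀ hP]
      linarith
    linarith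
  · -- small coupling: curvature of the truncated problems + S2
    have hE0fin : periodicGroundStateEnergy v N (sideLength ρ N) ≠ ⊤ :=
      ne_top_of_le_ne_top hΨ (periodicGroundStateEnergy_le v Ψ)
    set δ : ℝ := psq (sideLength ρ N) k * (periodicGroundStateEnergy v N (sideLength ρ N)).toReal -
      (N : ℝ) * t ^ 2 with hδ
    have hδpos : 0 < δ := by
      have : (N : ℝ) * t ^ 2 ≤ C₁ * N * t ^ 2 := by
        have h0 : 0 ≤ (N : ℝ) * t ^ 2 := by positivity
        nlinarith
      rw [hδ]
      linarith
    have hcore : ∀ ε : ℝ, 0 < ε →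
        (periodicGroundStateEnergy v N (sideLength ρ N)).toReal - C₁ * t ^ 2 * N / psq (sideLength ρ N) k ≤
          (periodicEnergy v Ψ).toReal + t * cosMean (sideLength ρ N) k Ψ + ε := by
      intro ε hε
      have hε' : 0 < min ε (δ / psq (sideLength ρ N) k) := lt_min hε (div_pos hδpos hP)
      obtain ⟨n₁, hn₁⟩ := h₂ v hv N (sideLength ρ N) hL hE0fin _ hε'
      set n := max n₀ n₁ with hn
      have hn0 : n₀ ≤ n := le_max_left _ _
      have hnn1 : n₁ ≤ n := le_max_right _ _
      have hS2 := hn₁ n hnn1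
      have hminε : min ε (δ / psq (sideLength ρ N) k) ≤ ε := min_le_left _ _
      have hminδ : min ε (δ / psq (sideLength ρ N) k) ≤ δ / psq (sideLength ρ N) k := min_le_right _ _
      -- the window of the curvature stub for the truncated problem contains `t`
      have hwin' : t ^ 2 ≤ psq (sideLength ρ N) k *
          (periodicGroundStateEnergy (truncPotential v n) N (sideLength ρ N)).toReal / N := by
        rw [le_div_iff₀ hNR]
        have h1 : psq (sideLength ρ N) k * (δ / psq (sideLength ρ N) k) = δ := by
          field_simp
        have h2 : psq (sideLength ρ N) k * (periodicGroundStateEnergy v N (sideLength ρ N)).toReal ≤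
            psq (sideLength ρ N) k *
                (periodicGroundStateEnergy (truncPotential v n) N (sideLength ρ N)).toReal +
              psq (sideLength ρ N) k * (δ / psq (sideLength ρ N) k) := by
          have := mul_le_mul_of_nonneg_left (hS2.trans (add_le_add le_rfl hminδ)) hP.le
          linarith [this]
        rw [h1, hδ] at h2
        linarith
      -- finiteness for the truncated problem
      have hΨn : periodicEnergy (truncPotential v n) Ψ ≠ ⊤ :=
        ne_top_of_le_ne_top hΨ (periodicEnergy_truncPotential_le'' v n Ψ)
      have hE0finn : periodicGroundStateEnergy (truncPotential v n) N (sideLength ρ N) ≠ ⊤ :=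
        ne_top_of_le_ne_top hΨn (periodicGroundStateEnergy_le _ Ψ)
      -- the curvature stub at height `n`, momentum `k`, as the hypothesis of `modulationBound_of_curvature`
      have hcurv : ∀ s : ℝ, s ^ 2 ≤ psq (sideLength ρ N) k *
            (periodicGroundStateEnergy (truncPotential v n) N (sideLength ρ N)).toReal / N →
          ∀ ε : ℝ, 0 < ε → ∃ δ₀ : ℝ, 0 < δ₀ ∧ ∀ δ : ℝ, 0 < δ → δ < δ₀ →
            -(2 * (K * N / psq (sideLength ρ N) k + ε) * δ ^ 2) ≤
              modInf (truncPotential v n) N (sideLength ρ N) k (s + δ) +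
                modInf (truncPotential v n) N (sideLength ρ N) k (s - δ) -
                2 * modInf (truncPotential v n) N (sideLength ρ N) k s :=
        fun s hs ε hε => hUV n hn0 ρ hρ hρ1 N hN1 k hk hUVcase s hs ε hε
      have hboot := modulationBound_of_curvature hB hT hL hk hE0finn (K' := K * N / psq (sideLength ρ N) k)
        (by positivity) hcurv t hwin' Ψ hΨn
      -- transfer energies from `v_n` to `v`
      have hEΨ : (periodicEnergy (truncPotential v n) Ψ).toReal ≤ (periodicEnergy v Ψ).toReal :=
        ENNReal.toReal_mono hΨ (periodicEnergy_truncPotential_le'' v n Ψ)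
      have hconst : K * N / psq (sideLength ρ N) k * t ^ 2 ≤ C₁ * t ^ 2 * N / psq (sideLength ρ N) k := by
        rw [div_mul_eq_mul_div, div_le_div_iff_of_pos_right hP]
        have h0 : 0 ≤ (N : ℝ) * t ^ 2 := by positivity
        nlinarith
      linarith
    have hfinal : (periodicGroundStateEnergy v N (sideLength ρ N)).toReal -
          C₁ * t ^ 2 * N / psq (sideLength ρ N) k ≤
        (periodicEnergy v Ψ).toReal + t * cosMean (sideLength ρ N) k Ψ :=
      le_of_forall_pos_le_add hcore
    have hextra : 0 ≤ (N : ℝ) * t ^ 2 / psq (sideLength ρ N) k := by positivity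
    linarith

/-- **The crux's unbundled body from the two halves** (`N = 0` by `Negative.ineq_N_zero`; split at `M₀²ρa`;
`ρ₀ = min`, `C = max`). [folklore] -/
theorem body_of_halves (h₁ : InfraredHalf) (hK : KineticBranch) :
    ∀ v : ℝ → ℝ≥0∞, IsRepulsiveFiniteRange v → ∃ ρ₀ : ℝ, 0 < ρ₀ ∧ ∃ C : ℝ, 0 < C ∧ Body v ρ₀ C := by
  intro v hv
  obtain ⟨M₀, hM₀, ρ₁, hρ₁, C₁, hC₁, hKin⟩ := hK v hv
  obtain ⟨ρ₂, hρ₂, C₂, hC₂, hPh⟩ := h₁ v hv M₀ hM₀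
  refine ⟨min ρ₁ ρ₂, lt_min hρ₁ hρ₂, max C₁ C₂, lt_of_lt_of_le hC₁ (le_max_left _ _), ?_⟩
  intro ρ hρ hρlt N k hk t Ψ hΨ
  rcases Nat.eq_zero_or_pos N with hN | hN
  · subst hN
    exact ineq_N_zero v _ ρ k t Ψ hΨ
  · rcases le_or_gt (psq (sideLength ρ N) k) (M₀ ^ 2 * (ρ * (scatteringLength v).toReal)) with hle | hlt
    · exact ineq_mono_C' (hPh ρ hρ (lt_of_lt_of_le hρlt (min_le_right _ _)) N hN k hk hle t Ψ hΨ)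
        (le_max_right _ _)
    · exact ineq_mono_C' (hKin ρ hρ (lt_of_lt_of_le hρlt (min_le_left _ _)) N hN k hk hlt t Ψ hΨ)
        (le_max_left _ _)

/-- The UV half from the registered stubs of v4. -/
theorem kineticBranch_holds : KineticBranch :=
  kineticBranch_of_curvature truncationLimit_holds modInfBasic_holds modInfTranslate_holds
    uvCurvatureBound_holds freeSquare_holds

/-- **`StaticResponseBound` from the line `uv-thomson-force-wave`, skeleton v4 (seat c1)**: the crux BY NAME; the only
`sorry`s in its cone are the registered stubs `stub_infraredHalf`, `stub_maxFormBound`, `stub_modInfBasic`,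
`stub_modInfTranslate`, `stub_uvCurvatureBound` (S6 and the bridges are landed). -/
theorem StaticResponseBound_of : StaticResponseBound :=
  staticResponseBound_iff.mpr (body_of_halves infraredHalf_holds kineticBranch_holds)

/-- **Kill-edge by name**: the IR half `stub_infraredHalf` implies the sibling route's open crux
`BECSectorPoincareTwoScale.TorusHyperuniformity` (stmt-AtomisticToContinuum-9093), via the registered
`stub_nearMinCosSqMoment` and `stub_torusHyperuniformityPackaging`. -/
theorem torusHyperuniformity_of_infraredHalf : BECSectorPoincareTwoScale.TorusHyperuniformity :=
  torusHyperuniformityPackaging_holds infraredHalf_holds nearMinCosSqMoment_holds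

end Summit.AtomisticToContinuum.BoseEinsteinCondensation.Cruxes.StaticResponseBound.UvThomsonForceWave

end
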